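import Literature.Barriers.AnomalousDissipation.ShearFlowViscositySelectionStepsProofs
import Literature.Barriers.AnomalousDissipation.ShearFlowViscositySelectionHeat
import Literature.Barriers.AnomalousDissipation.ShearFlowViscositySelectionLimitEqDischarge
import HarnessLib

/-!
# Bardos–Titi–Wiedemann 2012, Theorem 5 — assembly from the discharged facts

Theorem-only. The discharges in the tree —
`BardosTitiWiedemann2012_thm5_shearLerayHopf_holds` (`ShearFlowViscositySelectionStepsProofs`),
`BardosTitiWiedemann2012_thm5_heatLimit_holds` (`ShearFlowViscositySelectionHeat`),
`BardosTitiWiedemann2012_thm5_limitEq_holds` (`ShearFlowViscositySelectionLimitEqDischarge`),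
`BardosTitiWiedemann2012_lemma4_holds` (`ShearFlowViscositySelectionLemma4`) — combined with the
proved reductions `BardosTitiWiedemann2012_thm5_subseqLimit_of_facts`
(`ShearFlowViscositySelectionLimitSteps`) and `BardosTitiWiedemann2012_thm5_of_facts`
(`ShearFlowViscositySelectionLimit`) leave exactly one named fact between the tree and
`BardosTitiWiedemann2012_thm5`: the weak–strong uniqueness statement
`BardosTitiWiedemann2012_thm5_uniqueness` (Bardos–Lopes Filho–Niu–Nussenzveig Lopes–Titi 2013,
Thm. 3.1, as used in op. cit.). This file records that reduction as a theorem.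

* `BardosTitiWiedemann2012_thm5_subseqLimit_of_uniqueness` — part (iii) (vanishing viscosity
  limit) from uniqueness alone.
* `BardosTitiWiedemann2012_thm5_of_uniqueness` — the whole of Thm. 5 from uniqueness alone.

## References

* C. Bardos, E. S. Titi, E. Wiedemann, C. R. Math. Acad. Sci. Paris 350 (2012) 757–760, Thm. 5
  (`BardosTitiWiedemann2012`).
* C. Bardos, M. C. Lopes Filho, D. Niu, H. J. Nussenzveig Lopes, E. S. Titi, SIAM J. Math. Anal.
  45 (2013), Thm. 3.1 (`BardosEtAl2013`).
-/

noncomputable section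

namespace Literature.Barriers.AnomalousDissipation

/-- **Thm. 5 (iii) from uniqueness.** The vanishing viscosity limit statement
`BardosTitiWiedemann2012_thm5_subseqLimit` (equivalent to conjunct (iii) of
`BardosTitiWiedemann2012_thm5`) follows from the weak–strong uniqueness fact alone, all other
ingredients being proved in the tree. [cite: BardosTitiWiedemann2012, Thm. 5] -/
theorem BardosTitiWiedemann2012_thm5_subseqLimit_of_uniqueness (huniq : BardosTitiWiedemann2012_thm5_uniqueness) :
    BardosTitiWiedemann2012_thm5_subseqLimit :=
  BardosTitiWiedemann2012_thm5_subseqLimit_of_facts BardosTitiWiedemann2012_thm5_shearLerayHopf_holds huniq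
    BardosTitiWiedemann2012_thm5_heatLimit_holds BardosTitiWiedemann2012_thm5_limitEq_holds

/-- **Bardos–Titi–Wiedemann 2012, Thm. 5, from uniqueness.** The full statement
`BardosTitiWiedemann2012_thm5` (existence, uniqueness, and the weak-* vanishing viscosity limit to
the shear flow for every `T > 0`) follows from the weak–strong uniqueness fact
`BardosTitiWiedemann2012_thm5_uniqueness` alone. [cite: BardosTitiWiedemann2012, Thm. 5] -/
theorem BardosTitiWiedemann2012_thm5_of_uniqueness (huniq : BardosTitiWiedemann2012_thm5_uniqueness) :
    BardosTitiWiedemann2012_thm5 :=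
  BardosTitiWiedemann2012_thm5_of_facts huniq (BardosTitiWiedemann2012_thm5_subseqLimit_of_uniqueness huniq)

end Literature.Barriers.AnomalousDissipation

end
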